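import Literature.Claims.NS.Baev2022
import Literature.Analysis.FluidPDE.PeriodicGalileanNonuniqueness
import HarnessLib

/-!
# C113 `Baev2022` — addendum: the data class of the (11)-reading is `{0}`

Cell ns-claims (D-0090), row C113 (ADJUDICATED #84: false lemma at `Eq12`).  The skeleton
`Literature.Claims.NS.Baev2022` records (Δ4) that under the paper's standing assumption (11)
`(v₀,∇)v₀ = 0` (p.7, p.10, p.14) the data class is narrower than Clay's and leaves the remark
«a rapidly decreasing field with `(v₀,∇)v₀ = 0` is constant along its own straight integral lines,
hence `0` — refuter's remark to check».  This file checks it in the kernel: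

* `eq_zero_of_convect_self_eq_zero_of_decay` — **a `C¹` field with `(U·∇)U ≡ 0` and
  `(1 + |y|)|U(y)| ≤ C` vanishes** (any normed space): along the straight line `t ↦ x₀ + tU(x₀)`
  the defect `w(t) = U(x₀ + tU(x₀)) − U(x₀)` solves `w' = −DU(x₀ + tU(x₀)) w`, `w(0) = 0`, so
  `w ≡ 0` (Grönwall on every `[0,b]`); the particle keeps the speed `|U(x₀)| ≠ 0` while
  `|x₀ + tU(x₀)| → ∞`, against the decay.  (The compact-support version is
  `Summit.NavierStokesRegularity.NavierStokesRegularity.Theorems.eq_zero_of_convect_self_eq_zero`.)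
* `isDatum_cond11_iff` — `IsDatum v₀ ∧ Cond11 v₀ ↔ v₀ = 0`: the (11)-class of smooth, divergence
  free, rapidly decreasing data (Clay (4)) is the zero datum alone.
* `claimedTheorem11_holds` — hence the (11)-reading `ClaimedTheorem11` of Теорема 3 / Следствие 4
  is TRUE, witnessed by the rest state `v ≡ 0`, `p ≡ 0` only: it says nothing about any non-zero
  datum (vacuous data class), in particular nothing about Clay (A).

Refuter-2 (cell ns-claims), 2026-08-27.  WHAT THIS IS NOT: not a claim about NS regularity or
blow-up; not a claim about any author beyond the typed locator.
-/

noncomputable section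

-- the summit-side namespace repeats a component by design (D-0017)
set_option linter.dupNamespace false

namespace Summit.NavierStokesRegularity.NavierStokesRegularity.Theorems.Baev2022

open Set Metric Filter Topology
open scoped ContDiff
open Literature.Analysis.FluidPDE Literature.Claims.NS.Baev2022

/-- **A decaying `C¹` field with straight streamlines vanishes.**  If `U` is `C¹`,
`(1 + ‖y‖) ‖U y‖ ≤ C` for all `y`, and `DU(x)[U x] = 0` for all `x` (`(U·∇)U ≡ 0`,
`Literature.Analysis.FluidPDE.convect U U`), then `U = 0`. [folklore] -/
theorem eq_zero_of_convect_self_eq_zero_of_decay {E : Type*} [NormedAddCommGroup E]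
    [NormedSpace ℝ E] {U : E → E} (hU : ContDiff ℝ 1 U)
    (hdec : ∃ C : ℝ, ∀ y, (1 + ‖y‖) * ‖U y‖ ≤ C) (h : ∀ x, fderiv ℝ U x (U x) = 0) : U = 0 := by
  obtain ⟨C, hC⟩ := hdec
  have hdiff : Differentiable ℝ U := hU.differentiable one_ne_zero
  have hcontD : Continuous (fderiv ℝ U) := hU.continuous_fderiv one_ne_zero
  funext x₀
  by_contra hx₀
  simp only [Pi.zero_apply] at hx₀
  set v : E := U x₀ with hv
  have hvpos : 0 < ‖v‖ := norm_pos_iff.2 hx₀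
  -- the defect along the straight line
  set w : ℝ → E := fun t => U (x₀ + t • v) - v with hw
  have hline : ∀ t, HasDerivAt (fun t : ℝ => x₀ + t • v) v t := fun t => by
    simpa using ((hasDerivAt_id t).smul_const v).const_add x₀
  have hderiv : ∀ t, HasDerivAt w (fderiv ℝ U (x₀ + t • v) v) t := fun t => by
    have h1 : HasDerivAt (fun t : ℝ => U (x₀ + t • v)) (fderiv ℝ U (x₀ + t • v) v) t :=
      ((hdiff (x₀ + t • v)).hasFDerivAt.comp_hasDerivAt t (hline t))
    simpa [hw] using h1.sub_const v
  -- the linear ODE `w' = -DU w`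
  have hkey : ∀ t, fderiv ℝ U (x₀ + t • v) v = -(fderiv ℝ U (x₀ + t • v) (w t)) := fun t => by
    simp only [hw, map_sub, h (x₀ + t • v), zero_sub, neg_neg]
  have hzero : ∀ b : ℝ, 0 ≤ b → w b = 0 := fun b hb => by
    -- a bound on `DU` along the segment `[0,b]`
    obtain ⟨K, hK⟩ : ∃ K : ℝ, ∀ t ∈ Icc (0 : ℝ) b, ‖fderiv ℝ U (x₀ + t • v)‖ ≤ K := by
      have hc : Continuous fun t : ℝ => fderiv ℝ U (x₀ + t • v) :=
        hcontD.comp (continuous_const.add (continuous_id.smul continuous_const))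
      exact isCompact_Icc.exists_bound_of_continuousOn hc.continuousOn
    exact eq_zero_of_abs_deriv_le_mul_abs_self_of_eq_zero_right (K := K)
      (fun t _ => (hderiv t).continuousAt.continuousWithinAt)
      (fun t _ => (hderiv t).hasDerivWithinAt)
      (by simp [hw, hv])
      (fun t ht => by
        rw [hkey t, norm_neg]
        exact (ContinuousLinearMap.le_opNorm _ _).trans
          (mul_le_mul_of_nonneg_right (hK t (Ico_subset_Icc_self ht)) (norm_nonneg _)))
      b ⟨hb, le_rfl⟩
  -- far out along the line the decay bound fails: the field still equals `v ≠ 0` there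
  have hCx₀ : (1 + ‖x₀‖) * ‖v‖ ≤ C := hC x₀
  have hCpos : 0 < C := lt_of_lt_of_le (by positivity) hCx₀
  set t₁ : ℝ := (C / ‖v‖ + ‖x₀‖) / ‖v‖ with ht₁
  have ht₁pos : 0 ≤ t₁ := by rw [ht₁]; positivity
  have hUy : U (x₀ + t₁ • v) = v := by
    have := hzero t₁ ht₁pos
    rwa [hw, sub_eq_zero] at this
  have hy : C / ‖v‖ ≤ ‖x₀ + t₁ • v‖ := by
    have h2 : t₁ * ‖v‖ - ‖x₀‖ ≤ ‖x₀ + t₁ • v‖ := by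
      have := norm_sub_norm_le (t₁ • v) (-x₀)
      rw [norm_smul, Real.norm_eq_abs, abs_of_nonneg ht₁pos, norm_neg, sub_neg_eq_add,
        add_comm] at this
      linarith
    have h3 : t₁ * ‖v‖ = C / ‖v‖ + ‖x₀‖ := by rw [ht₁, div_mul_cancel₀ _ hvpos.ne']
    linarith
  have h4 := hC (x₀ + t₁ • v)
  rw [hUy] at h4
  have h5 : (1 + C / ‖v‖) * ‖v‖ ≤ C :=
    (mul_le_mul_of_nonneg_right (by linarith) hvpos.le).trans h4
  rw [add_mul, one_mul, div_mul_cancel₀ _ hvpos.ne'] at h5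
  linarith

/-- **The (11)-data class is the zero datum**: a smooth, divergence-free, rapidly decreasing
(Clay (4)) field `v₀` on `ℝ³` with `(v₀,∇)v₀ = 0` ((11) p.7) is `0`, and `0` is such a field.
[cite: Baev2022ru, (10)–(11) p.7; p.10; p.14] -/
theorem isDatum_cond11_iff (v₀ : E3 → E3) : IsDatum v₀ ∧ Cond11 v₀ ↔ v₀ = 0 := by
  constructor
  · rintro ⟨⟨hsmooth, -, hdecay⟩, h11⟩
    refine eq_zero_of_convect_self_eq_zero_of_decay (hsmooth.of_le (mod_cast le_top)) ?_
      (fun x => h11 x)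
    obtain ⟨C, hC⟩ := hdecay 0 1
    exact ⟨C, fun y => by simpa [norm_iteratedFDeriv_zero] using hC y⟩
  · rintro rfl
    refine ⟨⟨contDiff_const, fun x => ?_, fun n K => ⟨0, fun x => ?_⟩⟩, fun x => ?_⟩
    · have h1 : (0 : E3 → E3) = fun _ => (0 : E3) := rfl
      rw [NSWave0.divergence, h1, fderiv_const_apply]
      simp
    · simp
    · simp [convect]

/-- **The (11)-reading of the claimed theorem is true — for the zero datum, the only one in its
class**: `ClaimedTheorem11` holds, witnessed by the rest state `v ≡ 0` with pressure `0`
(`Literature.Analysis.FluidPDE.isNavierStokesSolution_zero`); by `isDatum_cond11_iff` no other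
datum is covered, so the sentence carries no information about Clay (A).
[cite: Baev2022ru, Теорема 3 p.15 with (11) p.7, p.14] -/
theorem claimedTheorem11_holds : ClaimedTheorem11 := by
  intro ε _ v₀ hd h11
  obtain rfl : v₀ = 0 := (isDatum_cond11_iff v₀).1 ⟨hd, h11⟩
  obtain ⟨h1, h2, -⟩ := isNavierStokesSolution_zero (E := E3) ε
  refine ⟨0, ⟨h2, h1⟩, fun M hM t _ x => ?_, fun t _ => le_rfl⟩
  simpa using hM x

end Summit.NavierStokesRegularity.NavierStokesRegularity.Theorems.Baev2022
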